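import Summits.QuantumFields.YangMills.Theorems.UnitScaleTiltFluctuationComparisonRegPrIntLStub1
import Literature.MathematicalPhysics.QuantumFieldTheory.Balaban1983to89.T3SmallLiftHistory
import HarnessLib

/-!
# `FluctuationComparisonRegPrIntLInteriorSectionPointwise` — LINE g22-4 «persistence_geometry», row GEOM∘ `InteriorSectionCan`: THE POINTWISE INTERIOR SECTION
# OF THE ONE-STEP AVERAGING WITH A PLAQUETTE MARGIN, CLOSED FROM THE LANDED W7 SMALL LIFT
# (crux `UnitScaleTilt.FluctuationComparisonRegPrIntL`, stmt-QuantumFields-20520; row GEOM∘ of `Cruxes/FluctuationComparisonRegPrIntL/Lines/persistence_geometry.lean`,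
# ideator ym-r3-idea-1 g22; existence half located by ym3-torus-px21 g13, 2026-08-30 05:40Z)

Cell `ym3-torus` (YM ladder rung R3 = continuum SU(2) Yang–Mills on T³ — a RUNG, NOT the Clay problem: not d = 4, not infinite volume, not a mass gap);
width seat `ym-ust-20520-w3` (gen 18, LEAD-20520); helper `--supports stmt-QuantumFields-20520`.  THEOREMS ONLY (0 `def`, 0 `sorry`, default heartbeats).

WHAT.  GEOM∘ asks, in the organ's shared shape, for every window level `J`: a margin `r > 0` and a MEASURABLE map `σ` from level-`J` to level-`(J+1)`
configurations with `D_{J,J+1}(σ U) = U` and every plaquette of `σ U` below `θ_{J+1}(c·b₀) − 4r`, for every interior datum `U ∈ W_J(c·b₀)`.  This file proves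
the same sentence with `∃ σ, Measurable σ ∧ ∀ U, …(σ U)` replaced by `∀ U, … ∃ Uf, …Uf` — i.e. GEOM∘'s EXISTENCE-WITH-MARGIN half, pointwise in the datum — from
the tree's one-step small lift ✓`IntLStub1.stub_oneStepSmallLift : ∀ L, ∃ κ δ₀, κ√L ≤ 1 ∧ 0 < δ₀ ∧ ∀ F, F.L = L → OneStepSmallLift F ℰp κ δ₀` (W7 line of
crux 19201, `ApproxLift.AnsatzT.stub_oneStepSmallLift`, p490827):
* §1 ★`pFun_lt_pFun_of_lt`, ★`coupling_succ_lt`, ★`sqrt_inv_mul_θBal_lt_succ` — the STRICT window ratio `√(L⁻¹)·θ_i < θ_{i+1}` (`1 < L`, `0 < γ ≤ 1`,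
  `0 < b₀`, `0 < p₀`; lit ✓`T3SmallLiftHistory.sqrt_inv_mul_θBal_le_succ` is the `≤`); ★`mul_θBal_lt_θBal_succ : κ√L ≤ 1 → κ·θ_i < θ_{i+1}` — THE MARGIN.
* §2 ★★`exists_descendTo_eq_plaqSmall_pow` — `OneStepSmallLift F ℰ κ δ₀` with `0 < κ ≤ 1`, a `δ`-small datum `V` of the `n`-th approximation (`0 < δ ≤ δ₀`) and
  `n ≤ K` give a run-`K` configuration `U` with `descendTo F ℰ n K U = V` and `PlaqSmall (κ^{K−n}·δ) U` (lit ✓`exists_preimage_iter_small` along the height profile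
  `ϑ k = κ^{K−n−k}·δ`, `fieldShift` bookkeeping of lit ✓`exists_mem_fibre_histGood` — with the GAIN KEPT instead of the history thresholds).
* §3 ★★★`interiorSection_pointwise` — GEOM∘'s text (g22-4 `persistence_geometry.lean` 970dcf79 ll.117–123) VERBATIM except the selector: `c₀ := 1`, `pS := 0`,
  `γ₁ :=` lit ✓`T3Thresholds.exists_gamma_forall_θBal_le` at `(c·b₀, p₀, δ₀(L))` (every window radius `≤ δ₀`), gain `κ' := max κ ((√L)⁻¹∕2) > 0` (still `κ'√L ≤ 1`),
  margin `r := (θ_{J+1}(c·b₀) − κ'·θ_J(c·b₀))∕4 > 0` by §1.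
* §4 ★★★`interiorSectionCan_of_measurableSelection : ⟨MEAS-SEL⟩ → GEOM∘ VERBATIM` (the residue named as ONE hypothesis: a measurable selection of the pointwise
  section); §5 ★★★`interiorSection_choice` — GEOM∘'s text with the conjunct `Measurable σ` DELETED, closed by choice (for a measurability-free re-typing of GEOM∘∕TUBE∘).
SO: GEOM∘'s residue is EXACTLY `Measurable σ` — a measurable (e.g. continuous) selection of this pointwise section (Kuratowski–Ryll-Nardzewski is not in Mathlib;
the honest road is continuity of the W7 lift re-assembled as a map).
HONEST SCOPE.  Bookkeeping over the landed W7 lift; its `L = 3` clause rests on the certified face-supported table (`CertL3Tree.certL3_clause`, `native_decide`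
certificate facts), so this file is computational in the same sense as p490827.  GEOM∘ as typed (with `Measurable σ`), TUBE∘, PERS₁∘, PLAQTAIL∘, LFR♯ᶜ∘, S2β,
20520, `YM3TorusSU2` NOT proved; the Yang–Mills mass gap is NOT proved.
HYP-SAT (cell RULING №42).  Hypothesis-free; the output carries GEOM∘'s letters at GEOM∘'s quantifier order (`r` after `F, γ, J`; `γ₁` after `L, c, b₀, p₀`).
References: [Balaban1987RG1] (0.4) p. 253, (0.18) p. 255; [Balaban1985UV3] (3) p. 256, (7) p. 257; [Balaban1985Averaging] (8)–(10) p. 19.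
-/

noncomputable section

set_option autoImplicit false

open Literature.MathematicalPhysics.QuantumFieldTheory.Balaban1983to89
open Literature.MathematicalPhysics.QuantumFieldTheory.Balaban1983to89.T3ContinuumYM3Torus
open Literature.MathematicalPhysics.QuantumFieldTheory.Balaban1983to89.T3LevelShift
open Literature.MathematicalPhysics.QuantumFieldTheory.Balaban1983to89.T3UnitLawDensityEML (ℰp)
open Literature.MathematicalPhysics.QuantumFieldTheory.Balaban1983to89.T3UnitScaleTilt
open Literature.MathematicalPhysics.QuantumFieldTheory.Balaban1983to89.T3TiltDescent
open Literature.MathematicalPhysics.QuantumFieldTheory.Balaban1983to89.T3Thresholds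
open Literature.MathematicalPhysics.QuantumFieldTheory.Balaban1983to89.T3ThresholdSmallness (sqrt_coupling_pos_le)
open Literature.MathematicalPhysics.QuantumFieldTheory.Balaban1983to89.T3MinimiserStabilityReduction (θBal_pos)
open Literature.MathematicalPhysics.QuantumFieldTheory.Balaban1983to89.T3SmallLiftHistory

namespace Summit.QuantumFields.YangMills.Theorems.FluctuationComparisonRegPrIntLInteriorSectionPointwise

/-! ## §1 The strict window ratio and the margin -/

section Ratio

variable {L : ℕ} {γ b₀ p₀ : ℝ}

/-- `p(g) = b₀(1 + log g⁻¹)^{p₀}` is STRICTLY antitone in the coupling on `(0, 1]` when `b₀, p₀ > 0`. [cite: Balaban1985UV3, (7) p.257] -/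
theorem pFun_lt_pFun_of_lt (hb : 0 < b₀) (hp : 0 < p₀) {g g' : ℝ} (hg : 0 < g) (hgg' : g < g') (hg'1 : g' ≤ 1) :
    B10.pFun b₀ p₀ g' < B10.pFun b₀ p₀ g := by
  unfold B10.pFun
  have hg' : 0 < g' := hg.trans hgg'
  have hlog' : 0 ≤ Real.log g'⁻¹ := Real.log_nonneg ((one_le_inv₀ hg').mpr hg'1)
  have hlt : Real.log g'⁻¹ < Real.log g⁻¹ := Real.log_lt_log (inv_pos.mpr hg') ((inv_lt_inv₀ hg' hg).mpr hgg')
  exact mul_lt_mul_of_pos_left (Real.rpow_lt_rpow (by linarith) (by linarith) hp) hb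

/-- `g_{i+1} < g_i` strictly (`1 < L`, `0 < γ`): `g_i = √(γL^{-i})`. [cite: Balaban1985UV3, (3) p.256] -/
theorem coupling_succ_lt (hL : 1 < L) (hγ : 0 < γ) (i : ℕ) :
    Real.sqrt (γ * ((L : ℝ)⁻¹) ^ (i + 1)) < Real.sqrt (γ * ((L : ℝ)⁻¹) ^ i) := by
  have hL' : (1 : ℝ) < L := by exact_mod_cast hL
  have hLinv : ((L : ℝ)⁻¹) < 1 := inv_lt_one_of_one_lt₀ hL'
  have hLinv0 : 0 < ((L : ℝ)⁻¹) := inv_pos.mpr (zero_lt_one.trans hL')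
  have hpos : 0 < γ * ((L : ℝ)⁻¹) ^ i := mul_pos hγ (pow_pos hLinv0 i)
  refine Real.sqrt_lt_sqrt (mul_pos hγ (pow_pos hLinv0 _)).le ?_
  rw [pow_succ, ← mul_assoc]
  exact mul_lt_of_lt_one_right hpos hLinv

/-- ★ **THE STRICT WINDOW RATIO `√(L⁻¹)·θ(i) < θ(i+1)`**: `θ(i+1)/θ(i) = L^{-1/2}·p(g_{i+1})/p(g_i) > L^{-1/2}` (`1 < L`, `0 < γ ≤ 1`, `b₀, p₀ > 0`) — lit
✓`sqrt_inv_mul_θBal_le_succ` made strict: `p` strictly antitone and `g_{i+1} < g_i`. [cite: Balaban1985UV3, (3) p.256 and (7) p.257] -/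
theorem sqrt_inv_mul_θBal_lt_succ (hL : 1 < L) (hγ : 0 < γ) (hγ1 : γ ≤ 1) (hb : 0 < b₀) (hp : 0 < p₀) (i : ℕ) :
    Real.sqrt ((L : ℝ)⁻¹) * θBal L γ b₀ p₀ i < θBal L γ b₀ p₀ (i + 1) := by
  rw [θBal_eq, θBal_eq]
  have hL1 : 1 ≤ L := hL.le
  have hLinv : 0 ≤ ((L : ℝ)⁻¹) := inv_nonneg.mpr (Nat.cast_nonneg L)
  have hgi1 : Real.sqrt (γ * ((L : ℝ)⁻¹) ^ i) ≤ 1 := coupling_le_one hL1 hγ hγ1 i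
  have hsucc : Real.sqrt (γ * ((L : ℝ)⁻¹) ^ (i + 1)) = Real.sqrt ((L : ℝ)⁻¹) * Real.sqrt (γ * ((L : ℝ)⁻¹) ^ i) := by
    rw [← Real.sqrt_mul hLinv]
    congr 1
    ring
  have hlt : Real.sqrt (γ * ((L : ℝ)⁻¹) ^ (i + 1)) < Real.sqrt (γ * ((L : ℝ)⁻¹) ^ i) := coupling_succ_lt hL hγ i
  have hpos' : 0 < Real.sqrt (γ * ((L : ℝ)⁻¹) ^ (i + 1)) := (sqrt_coupling_pos_le hL1 hγ (i + 1)).1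
  have hp_lt : B10.pFun b₀ p₀ (Real.sqrt (γ * ((L : ℝ)⁻¹) ^ i)) < B10.pFun b₀ p₀ (Real.sqrt (γ * ((L : ℝ)⁻¹) ^ (i + 1))) :=
    pFun_lt_pFun_of_lt hb hp hpos' hlt hgi1
  calc Real.sqrt ((L : ℝ)⁻¹) * (Real.sqrt (γ * ((L : ℝ)⁻¹) ^ i) * B10.pFun b₀ p₀ (Real.sqrt (γ * ((L : ℝ)⁻¹) ^ i)))
      = Real.sqrt (γ * ((L : ℝ)⁻¹) ^ (i + 1)) * B10.pFun b₀ p₀ (Real.sqrt (γ * ((L : ℝ)⁻¹) ^ i)) := by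
        rw [hsucc]; ring
    _ < Real.sqrt (γ * ((L : ℝ)⁻¹) ^ (i + 1)) * B10.pFun b₀ p₀ (Real.sqrt (γ * ((L : ℝ)⁻¹) ^ (i + 1))) :=
        mul_lt_mul_of_pos_left hp_lt hpos'

/-- ★ **A GAIN `κ` WITH `κ√L ≤ 1` BEATS THE THRESHOLD RATIO STRICTLY**: `κ·θ(i) < θ(i+1)` — the room for a plaquette margin. [cite: Balaban1985UV3, (3) p.256 and (7) p.257] -/
theorem mul_θBal_lt_θBal_succ (hL : 1 < L) (hγ : 0 < γ) (hγ1 : γ ≤ 1) (hb : 0 < b₀) (hp : 0 < p₀) {κ : ℝ}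
    (hκ : κ * Real.sqrt L ≤ 1) (i : ℕ) : κ * θBal L γ b₀ p₀ i < θBal L γ b₀ p₀ (i + 1) := by
  have hL' : (0 : ℝ) < Real.sqrt L := Real.sqrt_pos.mpr (by exact_mod_cast (zero_lt_one.trans hL))
  have hκ' : κ ≤ Real.sqrt ((L : ℝ)⁻¹) := by
    rw [Real.sqrt_inv, ← one_div]
    exact (le_div_iff₀ hL').mpr hκ
  have hθ0 : 0 < θBal L γ b₀ p₀ i := θBal_pos hL.le hγ hγ1 hb p₀ i
  exact (mul_le_mul_of_nonneg_right hκ' hθ0.le).trans_lt (sqrt_inv_mul_θBal_lt_succ hL hγ hγ1 hb hp i)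

end Ratio

/-! ## §2 One W7 descent, read through `descendTo`, with the gain kept -/

section Lift

variable (F : T3Family) {G : Type*} [GaugeGroup G] (ℰ : LoopAverage G)

/-- ★★ **A SMALL DATUM HAS A `κ^{K−n}`-SMALL PREIMAGE IN ITS DESCENT FIBRE.**  Under `OneStepSmallLift F ℰ κ δ₀` with `0 < κ ≤ 1`: every `δ`-small datum `V` of the
`n`-th approximation (`0 < δ ≤ δ₀`) has, in every run `K ≥ n`, a preimage `U` (`descendTo F ℰ n K U = V`) with ALL plaquettes `< κ^{K−n}·δ`.  (Lit
✓`exists_preimage_iter_small` along the height profile `ϑ k = κ^{K−n−k}·δ`; the `fieldShift` bookkeeping of lit ✓`exists_mem_fibre_histGood`, which records only the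
history thresholds — here the GAIN is kept.) [cite: Balaban1987RG1, (0.4) p.253 and (0.18) p.255] -/
theorem exists_descendTo_eq_plaqSmall_pow {κ δ₀ : ℝ} (hlift : OneStepSmallLift F ℰ κ δ₀) (hκ0 : 0 < κ) (hκ1 : κ ≤ 1)
    {n K : ℕ} (h : n ≤ K) {δ : ℝ} (hδ : 0 < δ) (hδ₀ : δ ≤ δ₀)
    {V : GaugeField (F.P n) 0 G} (hV : PlaqSmall δ V) :
    ∃ U : GaugeField (F.P K) 0 G, descendTo F ℰ n K h U = V ∧ PlaqSmall (κ ^ (K - n) * δ) U := by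
  have hκpow1 : ∀ j : ℕ, κ ^ j ≤ 1 := fun j => pow_le_one₀ hκ0.le hκ1
  have hϑpos : ∀ k, 0 < κ ^ (K - n - k) * δ := fun k => mul_pos (pow_pos hκ0 _) hδ
  have hϑδ : ∀ k, κ ^ (K - n - k) * δ ≤ δ₀ := fun k => (mul_le_of_le_one_left hδ.le (hκpow1 _)).trans hδ₀
  have hϑ : ∀ k, κ * (κ ^ (K - n - (k + 1)) * δ) ≤ κ ^ (K - n - k) * δ := by
    intro k
    by_cases hk : k + 1 ≤ K - n
    · have : K - n - k = (K - n - (k + 1)) + 1 := by omega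
      rw [this, pow_succ]
      exact le_of_eq (by ring)
    · have h1 : K - n - (k + 1) = 0 := by omega
      have h2 : K - n - k = 0 := by omega
      rw [h1, h2, pow_zero, one_mul]
      exact mul_le_of_le_one_left hδ.le hκ1
  have hk : K - n ≤ (F.PP F.m K).m + (F.PP F.m K).K := by show K - n ≤ F.m + K; omega
  have hV' : PlaqSmall (κ ^ (K - n - (K - n)) * δ) (fieldShift (F.sitesPerDir_eq (m := F.m) (K := K) (j := K - n) (m' := F.m)
      (K' := n) (j' := 0) (by omega)) V) := fun p => by
    rw [plaqHol_fieldShift, Nat.sub_self, pow_zero, one_mul]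
    exact hV _
  obtain ⟨U, hU, hUsmall⟩ := exists_preimage_iter_small (P := F.PP F.m K) ℰ (fun j hj δ' hδ' hδ'' => hlift K j hj δ' hδ' hδ'')
    (fun k => κ ^ (K - n - k) * δ) hϑpos hϑδ hϑ (K - n) hk _ hV'
  refine ⟨U, ?_, hUsmall 0 (Nat.zero_le _)⟩
  show fieldShift _ (Averaging.iter (fun i => BlockAveraging.blockAvg (P := F.PP F.m K) (j := i) ℰ) (K - n) U) = V
  rw [hU, fieldShift_fieldShift]
  exact fieldShift_refl _ _

/-- ★ The depth-one case: `descendTo F ℰ J (J+1) U = V` with all plaquettes of `U` below `κ·δ`. [cite: Balaban1987RG1, (0.4) p.253 and (0.18) p.255] -/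
theorem exists_descendTo_succ_eq_plaqSmall {κ δ₀ : ℝ} (hlift : OneStepSmallLift F ℰ κ δ₀) (hκ0 : 0 < κ) (hκ1 : κ ≤ 1)
    (J : ℕ) {δ : ℝ} (hδ : 0 < δ) (hδ₀ : δ ≤ δ₀)
    {V : GaugeField (F.P J) 0 G} (hV : PlaqSmall δ V) :
    ∃ U : GaugeField (F.P (J + 1)) 0 G, descendTo F ℰ J (J + 1) (Nat.le_succ J) U = V ∧ PlaqSmall (κ * δ) U := by
  obtain ⟨U, hU, hUs⟩ := exists_descendTo_eq_plaqSmall_pow F ℰ hlift hκ0 hκ1 (Nat.le_succ J) hδ hδ₀ hV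
  have h1 : κ ^ (J + 1 - J) * δ = κ * δ := by rw [Nat.add_sub_cancel_left, pow_one]
  exact ⟨U, hU, fun p => (hUs p).trans_le h1.le⟩

end Lift

/-! ## §3 GEOM∘ pointwise: the interior section with a plaquette margin, from the landed W7 lift -/

section Geom

/-- ★★★ **GEOM∘ POINTWISE — AN INTERIOR PREIMAGE OF THE ONE-STEP AVERAGING WITH A PLAQUETTE MARGIN, FOR EVERY INTERIOR DATUM** (the text of LINE g22-4's row
`RunPairOrgan.PersistenceGeometry.InteriorSectionCan` with `∃ σ, Measurable σ ∧ ∀ U, …(σ U)` replaced by `∀ U, … ∃ Uf, …Uf`): for every block size `L` (`c₀ := 1`,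
`pS := 0`) and fractions∕profile letters in the shared order there is `γ₁ > 0` such that for every three-torus family with `F.L = L`, every `γ ∈ (0, γ₁]` and every
window level `J` there is a margin `r > 0` with: every interior datum `U ∈ W_J(c·b₀)` has a level-`(J+1)` configuration `Uf` with `descendTo F ℰp J (J+1) Uf = U` and
EVERY plaquette of `Uf` below `θ_{J+1}(c·b₀) − 4r`.  Proof: ✓`IntLStub1.stub_oneStepSmallLift` (gain `κ√L ≤ 1`, radius `δ₀`), `γ₁` so small that every window radius
`θ_i(c·b₀) ≤ δ₀` (lit ✓`exists_gamma_forall_θBal_le`), §2 at depth one, and the margin `4r = θ_{J+1}(c·b₀) − κ'·θ_J(c·b₀) > 0` of §1.  The selector's MEASURABILITY —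
GEOM∘'s only other content — is NOT supplied here. [cite: Balaban1987RG1, (0.4) p.253 and (0.18) p.255; Balaban1985UV3, (3) p.256 and (7) p.257] -/
theorem interiorSection_pointwise :
    ∀ (L : ℕ), ∃ c₀ : ℝ, 0 < c₀ ∧ c₀ ≤ 1 ∧ ∀ (c : ℝ), 0 < c → c ≤ c₀ → ∃ pS : ℝ, ∀ (b₀ p₀ : ℝ), 0 < b₀ → pS ≤ p₀ → 0 < p₀ →
      ∃ γ₁ : ℝ, 0 < γ₁ ∧ ∀ (F : T3Family) (γ : ℝ), F.L = L → 0 < γ → γ ≤ γ₁ →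
        ∀ (J : ℕ), ∃ r : ℝ, 0 < r ∧
          ∀ U : GaugeField (F.P J) 0 (Matrix.specialUnitaryGroup (Fin 2) ℂ), PlaqSmall (θBal F.L γ (c * b₀) p₀ J) U →
            ∃ Uf : GaugeField (F.P (J + 1)) 0 (Matrix.specialUnitaryGroup (Fin 2) ℂ),
              descendTo F ℰp J (J + 1) (Nat.le_succ J) Uf = U ∧ PlaqSmall (θBal F.L γ (c * b₀) p₀ (J + 1) - 4 * r) Uf := by
  intro L
  obtain ⟨κ, δ₀, hκL, hδ₀, hlift⟩ := Summit.QuantumFields.YangMills.Theorems.IntLStub1.stub_oneStepSmallLift L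
  refine ⟨1, one_pos, le_rfl, fun c hc _ => ⟨0, fun b₀ p₀ hb₀ _ hp₀ => ?_⟩⟩
  have hcb : 0 < c * b₀ := mul_pos hc hb₀
  obtain ⟨γ₁, hγ₁, hγ₁1, hθle⟩ := exists_gamma_forall_θBal_le (b₀ := c * b₀) (p₀ := p₀) hcb hp₀ hδ₀
  refine ⟨γ₁, hγ₁, fun F γ hFL hγ hγle J => ?_⟩
  subst hFL
  have hL : 1 < F.L := F.hL.2
  have hγ1 : γ ≤ 1 := hγle.trans hγ₁1
  -- a positive gain `κ' ≥ κ` with `κ'·√L ≤ 1`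
  have hsqrtL : (0 : ℝ) < Real.sqrt F.L := Real.sqrt_pos.mpr (by exact_mod_cast (zero_lt_one.trans hL))
  have hsqrtL1 : (1 : ℝ) ≤ Real.sqrt F.L := by
    rw [show (1 : ℝ) = Real.sqrt 1 from Real.sqrt_one.symm]
    exact Real.sqrt_le_sqrt (by exact_mod_cast hL.le)
  set κ' : ℝ := max κ ((Real.sqrt F.L)⁻¹ / 2) with hκ'_def
  have hκ'0 : 0 < κ' := lt_max_of_lt_right (by positivity)
  have hκ'L : κ' * Real.sqrt F.L ≤ 1 := by
    rcases le_total κ ((Real.sqrt F.L)⁻¹ / 2) with hle | hle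
    · rw [hκ'_def, max_eq_right hle]
      rw [div_mul_eq_mul_div, inv_mul_cancel₀ hsqrtL.ne']
      norm_num
    · rw [hκ'_def, max_eq_left hle]
      exact hκL
  have hκ'1 : κ' ≤ 1 := by
    calc κ' = κ' * 1 := (mul_one _).symm
      _ ≤ κ' * Real.sqrt F.L := mul_le_mul_of_nonneg_left hsqrtL1 hκ'0.le
      _ ≤ 1 := hκ'L
  have hlift' : OneStepSmallLift F ℰp κ' δ₀ := fun K j hj δ hδ hδ' =>
    (hlift F rfl K j hj δ hδ hδ').mono (le_max_left _ _) hδ.le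
  -- the margin
  refine ⟨(θBal F.L γ (c * b₀) p₀ (J + 1) - κ' * θBal F.L γ (c * b₀) p₀ J) / 4,
    by linarith [mul_θBal_lt_θBal_succ hL hγ hγ1 hcb hp₀ hκ'L J], fun U hU => ?_⟩
  have hδ : 0 < θBal F.L γ (c * b₀) p₀ J := θBal_pos hL.le hγ hγ1 hcb p₀ J
  have hδ' : θBal F.L γ (c * b₀) p₀ J ≤ δ₀ := hθle F.L hL.le γ hγ hγle J
  obtain ⟨Uf, hUf, hUfs⟩ := exists_descendTo_succ_eq_plaqSmall F ℰp hlift' hκ'0 hκ'1 J hδ hδ' hU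
  refine ⟨Uf, hUf, fun p => (hUfs p).trans_le (le_of_eq ?_)⟩
  ring

end Geom

/-! ## §4 GEOM∘ verbatim from a measurable selection of the pointwise section (the one residue, named as a hypothesis) -/

section Selection

/-- ★★★ **GEOM∘ `InteriorSectionCan` VERBATIM ⟸ A MEASURABLE SELECTION OF THE POINTWISE SECTION.**  Hypothesis ⟨MEAS-SEL⟩: for every family, level `J` and radii
`θ, θ'`, IF every `θ`-small level-`J` datum has a `θ'`-small preimage under the one-step descent `descendTo F ℰp J (J+1)` THEN there is a MEASURABLE map `σ` choosing
one (a measurable-selection principle for the continuous averaging map between products of `SU(2)` — classically Kuratowski–Ryll-Nardzewski on the compact-valued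
correspondence `U ↦ D⁻¹{U} ∩ {plaquettes ≤ θ''}`, or CONTINUITY of the W7 lift re-assembled as a map; NOT in the tree, NOT proved here).  Conclusion: the text of
LINE g22-4's `RunPairOrgan.PersistenceGeometry.InteriorSectionCan` (`persistence_geometry.lean` 970dcf79 ll.117–123) byte for byte, by §3.  HONEST SCOPE: a door;
⟨MEAS-SEL⟩ is GEOM∘'s whole remaining content and is the HYPOTHESIS. [cite: Balaban1987RG1, (0.4) p.253 and (0.18) p.255; Balaban1985Averaging, (8)-(10) p.19] -/
theorem interiorSectionCan_of_measurableSelection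
    (hsel : ∀ (F : T3Family) (J : ℕ) (θ θ' : ℝ),
      (∀ U : GaugeField (F.P J) 0 (Matrix.specialUnitaryGroup (Fin 2) ℂ), PlaqSmall θ U →
        ∃ Uf : GaugeField (F.P (J + 1)) 0 (Matrix.specialUnitaryGroup (Fin 2) ℂ),
          descendTo F ℰp J (J + 1) (Nat.le_succ J) Uf = U ∧ PlaqSmall θ' Uf) →
      ∃ σ : GaugeField (F.P J) 0 (Matrix.specialUnitaryGroup (Fin 2) ℂ) → GaugeField (F.P (J + 1)) 0 (Matrix.specialUnitaryGroup (Fin 2) ℂ),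
        Measurable σ ∧ ∀ U : GaugeField (F.P J) 0 (Matrix.specialUnitaryGroup (Fin 2) ℂ), PlaqSmall θ U →
          descendTo F ℰp J (J + 1) (Nat.le_succ J) (σ U) = U ∧ PlaqSmall θ' (σ U)) :
    ∀ (L : ℕ), ∃ c₀ : ℝ, 0 < c₀ ∧ c₀ ≤ 1 ∧ ∀ (c : ℝ), 0 < c → c ≤ c₀ → ∃ pS : ℝ, ∀ (b₀ p₀ : ℝ), 0 < b₀ → pS ≤ p₀ → 0 < p₀ →
      ∃ γ₁ : ℝ, 0 < γ₁ ∧ ∀ (F : T3Family) (γ : ℝ), F.L = L → 0 < γ → γ ≤ γ₁ →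
        ∀ (J : ℕ), ∃ r : ℝ, 0 < r ∧
          ∃ σ : GaugeField (F.P J) 0 (Matrix.specialUnitaryGroup (Fin 2) ℂ) → GaugeField (F.P (J + 1)) 0 (Matrix.specialUnitaryGroup (Fin 2) ℂ),
            Measurable σ ∧ ∀ U : GaugeField (F.P J) 0 (Matrix.specialUnitaryGroup (Fin 2) ℂ), PlaqSmall (θBal F.L γ (c * b₀) p₀ J) U →
              descendTo F ℰp J (J + 1) (Nat.le_succ J) (σ U) = U ∧ PlaqSmall (θBal F.L γ (c * b₀) p₀ (J + 1) - 4 * r) (σ U) := by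
  intro L
  obtain ⟨c₀, hc₀, hc₀1, hc⟩ := interiorSection_pointwise L
  refine ⟨c₀, hc₀, hc₀1, fun c hcpos hcle => ?_⟩
  obtain ⟨pS, hpS⟩ := hc c hcpos hcle
  refine ⟨pS, fun b₀ p₀ hb₀ hpS' hp₀ => ?_⟩
  obtain ⟨γ₁, hγ₁, hγ₁F⟩ := hpS b₀ p₀ hb₀ hpS' hp₀
  refine ⟨γ₁, hγ₁, fun F γ hFL hγ hγle J => ?_⟩
  obtain ⟨r, hr, hpw⟩ := hγ₁F F γ hFL hγ hγle J
  exact ⟨r, hr, hsel F J _ _ hpw⟩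

end Selection

/-! ## §5 GEOM∘ without the word «Measurable»: a (choice) section, for the measurability-free re-typing of GEOM∘∕TUBE∘ -/

section Choice

/-- ★★★ **GEOM∘ MINUS `Measurable σ ∧` — A SECTION BY CHOICE**: the text of LINE g22-4's `InteriorSectionCan` with the single conjunct `Measurable σ` deleted, i.e.
`∃ σ, ∀ U ∈ W_J(c·b₀), descendTo F ℰp J (J+1) (σ U) = U ∧ PlaqSmall (θ_{J+1}(c·b₀) − 4r) (σ U)` in the shared prefix — from §3 by `Classical.choice` (`σ U :=` the chosen
preimage on the window, `U ↦ 1` off it).  Use: if the line owner drops `Measurable σ` from GEOM∘ and TUBE∘ (the junction PERS₁∘ ⟸ GEOM∘ + TUBE∘ uses only monotonicity of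
the Gibbs OUTER measure on `D⁻¹B ∩ tube`, and TUBE∘'s content — a uniform-in-centre tube charge of the conditional law — bounds the outer measure from below for ANY centre
map `σ` via the disintegration of any measurable superset), then GEOM∘ so re-typed is THIS theorem, closed.  HONEST SCOPE: no measurability is claimed.
[cite: Balaban1987RG1, (0.4) p.253 and (0.18) p.255; Balaban1985UV3, (3) p.256 and (7) p.257] -/
theorem interiorSection_choice :
    ∀ (L : ℕ), ∃ c₀ : ℝ, 0 < c₀ ∧ c₀ ≤ 1 ∧ ∀ (c : ℝ), 0 < c → c ≤ c₀ → ∃ pS : ℝ, ∀ (b₀ p₀ : ℝ), 0 < b₀ → pS ≤ p₀ → 0 < p₀ →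
      ∃ γ₁ : ℝ, 0 < γ₁ ∧ ∀ (F : T3Family) (γ : ℝ), F.L = L → 0 < γ → γ ≤ γ₁ →
        ∀ (J : ℕ), ∃ r : ℝ, 0 < r ∧
          ∃ σ : GaugeField (F.P J) 0 (Matrix.specialUnitaryGroup (Fin 2) ℂ) → GaugeField (F.P (J + 1)) 0 (Matrix.specialUnitaryGroup (Fin 2) ℂ),
            ∀ U : GaugeField (F.P J) 0 (Matrix.specialUnitaryGroup (Fin 2) ℂ), PlaqSmall (θBal F.L γ (c * b₀) p₀ J) U →
              descendTo F ℰp J (J + 1) (Nat.le_succ J) (σ U) = U ∧ PlaqSmall (θBal F.L γ (c * b₀) p₀ (J + 1) - 4 * r) (σ U) := by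
  classical
  intro L
  obtain ⟨c₀, hc₀, hc₀1, hc⟩ := interiorSection_pointwise L
  refine ⟨c₀, hc₀, hc₀1, fun c hcpos hcle => ?_⟩
  obtain ⟨pS, hpS⟩ := hc c hcpos hcle
  refine ⟨pS, fun b₀ p₀ hb₀ hpS' hp₀ => ?_⟩
  obtain ⟨γ₁, hγ₁, hγ₁F⟩ := hpS b₀ p₀ hb₀ hpS' hp₀
  refine ⟨γ₁, hγ₁, fun F γ hFL hγ hγle J => ?_⟩
  obtain ⟨r, hr, hpw⟩ := hγ₁F F γ hFL hγ hγle J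
  refine ⟨r, hr, fun U => if hU : PlaqSmall (θBal F.L γ (c * b₀) p₀ J) U then (hpw U hU).choose else 1, fun U hU => ?_⟩
  simp only [dif_pos hU]
  exact (hpw U hU).choose_spec

end Choice

end Summit.QuantumFields.YangMills.Theorems.FluctuationComparisonRegPrIntLInteriorSectionPointwise

end
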